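import Literature.Computability.AlgebraicComplexity.TableauEvalContentDPProofs
import HarnessLib

/-!
# Support for content-state certificates: a memoised product table and keyed literal layers

Lean checker plumbing for the tableau highest-weight-vector certificates of the cell `val-lit`
(Dörfler–Ikenmeyer–Panova's toy model `Ch_4^7`; honest framing of that cell: kernel replay of a published
computer verification at a KNOWN separation; no claim about VP ≠ VNP or P ≠ NP is made here or there).

* §1 **The memoised coefficient table of a product of linear forms.** The table check `checkTable`
  (`ChowPointLabelMajorCertificates.lean`) evaluates p6's coefficient leaf `symEntryProd`, whose recursion
  `prodCoeffL` peels one form at a time WITHOUT memoisation — `4^m` leaves for `m` forms on `4` variables,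
  fine for the `m = 7` forms of a point of `Ch_4^7`, out of the kernel's reach for the `m = d ≥ 8` forms of
  the RECIPROCAL certificates (points of `Ch_4^d`). `prodTable V fs` computes the same coefficients level
  by level over the contents `allCounts V k` (memoised: `∑_k #contents · V` lookups), `checkTableFast`
  compares a certificate's table against it for a one-term point, and **`checkTable_of_checkTableFast`**
  transports the check to the tree's `checkTable` (`lookupC (prodTable V fs) α = prodCoeffL fs α` on
  contents of the right size, by the recursion of `prodCoeffL` itself).
* §2 **Keyed literal layers** for the content-state programme `evalM` (`TableauEvalContentDP.lean`): a
  layer entry `(key, state, value)` carries the state also in its key (digit `(u, v)` of weight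
  `keyBase ^ (u·V + v)`), so an intermediate layer shipped as a literal in a certificate module is written
  as `decodeLayerM V n [(key, value), …]` and the states are rebuilt by the kernel (the device of
  `TableauEvalKeyedLayers.lean` for the label-major programme). Nothing is proved about the decoder: a chunk
  lemma `layersM … = decodeLayerM V n L` is checked by the kernel like any literal.

Elementary [folklore] bookkeeping; no statement about representations is made in this file.

## References
* [DorflerIkenmeyerPanova2020] J. Dörfler, C. Ikenmeyer, G. Panova, *On geometric complexity theory:
  multiplicity obstructions are stronger than occurrence obstructions*, SIAM J. Appl. Algebra Geom. 4
  (2020) = arXiv:1901.04576, §5 (eq. (5.6): the symmetric-tensor entries `α! · [x^α] ∏ ℓ_s` of a product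
  of linear forms, and the dynamic programme over content vectors, arXiv p. 13).
-/

namespace Literature.Computability.AlgebraicComplexity

namespace TableauEval

/-! ## §1 The memoised coefficient table of a product of linear forms -/

section Table

variable {R : Type*} [CommRing R] [DecidableEq R]

/-- **Memoised coefficients of a product of linear forms**: the association list
`α ↦ [x^α] ∏_{ℓ ∈ fs} L_ℓ` over the contents `α ∈ allCounts V |fs|`, built form by form with the
recursion of `prodCoeffL` (`[x^α](L_ℓ · Q) = ∑_{i : α_i ≠ 0} ℓ[i] · [x^{α - e_i}] Q`) against the table
of the shorter product. [folklore] -/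
def prodTable (V : ℕ) : List (List R) → List (List ℕ × R)
  | [] => [(List.replicate V 0, 1)]
  | ℓ :: fs =>
    let T := prodTable V fs
    (allCounts V (fs.length + 1)).map fun α =>
      (α, ((List.range V).map fun i =>
        if α.getD i 0 = 0 then 0 else ℓ.getD i 0 * lookupC T (α.set i (α.getD i 0 - 1))).sum)

/-- **Fast table check for a one-term point** `c · ℓ_1 ⋯ ℓ_m`: the certificate's content table holds
`c · α! · [x^α] ∏ ℓ_s` at every content `α` of length-`m` words on `V` letters. [folklore] -/
def checkTableFast (V m : ℕ) (c : R) (fs : List (List R)) (tab : List (List ℕ × R)) : Bool :=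
  (fs.length == m) &&
    (allCounts V m).all fun cnt =>
      decide (lookupC tab cnt = c * ((((ffactL cnt : ℕ) : R)) * lookupC (prodTable V fs) cnt))

omit [CommRing R] [DecidableEq R] in
/-- Members of `allCounts V m` have length `V` and sum `m`. [folklore] -/
private theorem length_sum_of_mem_allCounts : ∀ (V m : ℕ) (cnt : List ℕ), cnt ∈ allCounts V m →
    cnt.length = V ∧ cnt.sum = m
  | 0, m, cnt, h => by
    unfold allCounts at h
    split_ifs at h with hm
    · simp at h; subst h; subst hm; simp
    · simp at h
  | V + 1, m, cnt, h => by
    unfold allCounts at h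
    simp only [List.mem_flatMap, List.mem_range, List.mem_map] at h
    obtain ⟨c, hc, cs, hcs, rfl⟩ := h
    obtain ⟨hl, hs⟩ := length_sum_of_mem_allCounts V (m - c) cs hcs
    refine ⟨by simp [hl], ?_⟩
    simp [hs]; omega

omit [CommRing R] [DecidableEq R] in
/-- Count vectors of length `V` and sum `m` are listed by `allCounts V m`. [folklore] -/
private theorem mem_allCounts' : ∀ (V m : ℕ) (cnt : List ℕ), cnt.length = V → cnt.sum = m →
    cnt ∈ allCounts V m
  | 0, m, cnt, hl, hs => by
    rw [List.length_eq_zero_iff] at hl; subst hl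
    simp only [List.sum_nil] at hs; subst hs
    simp [allCounts]
  | V + 1, m, [], hl, _ => by simp at hl
  | V + 1, m, c :: cs, hl, hs => by
    simp only [List.length_cons, Nat.add_right_cancel_iff] at hl
    simp only [List.sum_cons] at hs
    simp only [allCounts, List.mem_flatMap, List.mem_range, List.mem_map, List.cons.injEq]
    exact ⟨c, by omega, cs, mem_allCounts' V (m - c) cs hl (by omega), rfl, rfl⟩

omit [CommRing R] [DecidableEq R] in
/-- A count vector of sum zero is the zero vector. [folklore] -/
private theorem eq_replicate_of_sum_eq_zero : ∀ (cnt : List ℕ), cnt.sum = 0 →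
    cnt = List.replicate cnt.length 0
  | [], _ => rfl
  | c :: cs, h => by
    simp only [List.sum_cons, Nat.add_eq_zero_iff] at h
    rw [List.length_cons, List.replicate_succ, h.1, ← eq_replicate_of_sum_eq_zero cs h.2]

omit [CommRing R] [DecidableEq R] in
/-- Lowering one entry lowers the sum accordingly. [folklore] -/
private theorem sum_set_pred : ∀ (cnt : List ℕ) (i : ℕ), cnt.getD i 0 ≠ 0 →
    (cnt.set i (cnt.getD i 0 - 1)).sum + 1 = cnt.sum
  | [], i, h => by simp at h
  | c :: cs, 0, h => by
    simp only [List.getD_cons_zero] at h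
    simp only [List.getD_cons_zero, List.set_cons_zero, List.sum_cons]
    omega
  | c :: cs, i + 1, h => by
    simp only [List.getD_cons_succ] at h
    simp only [List.getD_cons_succ, List.set_cons_succ, List.sum_cons]
    have := sum_set_pred cs i h
    omega

omit [DecidableEq R] in
/-- Lookup in a table listing a function over a list finds the function value. [folklore] -/
private theorem lookupC_map_fun (L : List (List ℕ)) (g : List ℕ → R) (α : List ℕ) (hα : α ∈ L) :
    lookupC (L.map fun a => (a, g a)) α = g α := by
  unfold lookupC
  cases hf : (L.map fun a => (a, g a)).find? (fun e => e.1 == α) with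
  | none =>
    exfalso
    rw [List.find?_eq_none] at hf
    exact hf (α, g α) (List.mem_map.mpr ⟨α, hα, rfl⟩) (beq_self_eq_true α)
  | some e =>
    simp only
    obtain ⟨a, _, rfl⟩ := List.mem_map.mp (List.mem_of_find?_eq_some hf)
    have h1 := List.find?_some hf
    have h2 : a = α := by simpa using h1
    rw [h2]

omit [DecidableEq R] in
/-- **The memoised table is the coefficient leaf**: on the contents of length-`|fs|` words,
`lookupC (prodTable V fs) α = prodCoeffL fs α`. [folklore] -/
private theorem lookupC_prodTable (V : ℕ) : ∀ (fs : List (List R)) (α : List ℕ),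
    α ∈ allCounts V fs.length → lookupC (prodTable V fs) α = prodCoeffL fs α
  | [], α, hα => by
    obtain ⟨hl, hs⟩ := length_sum_of_mem_allCounts V 0 α hα
    have hz := eq_replicate_of_sum_eq_zero α hs
    rw [hl] at hz
    subst hz
    rw [prodTable, prodCoeffL, if_pos (by simp)]
    exact lookupC_map_fun [List.replicate V 0] (fun _ => (1 : R)) _ (List.mem_singleton.mpr rfl)
  | ℓ :: fs, α, hα => by
    rw [List.length_cons] at hα
    obtain ⟨hl, hs⟩ := length_sum_of_mem_allCounts V _ α hα
    rw [prodTable, lookupC_map_fun _ _ α hα, prodCoeffL, hl]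
    congr 1
    refine List.map_congr_left fun i _ => ?_
    split_ifs with h0
    · rfl
    · congr 1
      refine lookupC_prodTable V fs _ (mem_allCounts' V fs.length _ (by simp [hl]) ?_)
      have := sum_set_pred α i h0
      omega

omit [CommRing R] [DecidableEq R] in
/-- `countNat` is `List.count`. [folklore] -/
private theorem countNat_eq_count (a : ℕ) : ∀ l : List ℕ, countNat a l = l.count a
  | [] => by simp [countNat]
  | b :: l => by
    have IH := countNat_eq_count a l
    simp only [countNat] at IH ⊢
    rw [List.filter_cons, List.count_cons]
    by_cases h : b = a
    · subst h; simp [IH]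
    · simp [h, IH, beq_eq_false_iff_ne.mpr h]

omit [CommRing R] [DecidableEq R] in
/-- The letter counts of the canonical word of a content. [folklore] -/
private theorem countNat_repWord (V : ℕ) (cnt : List ℕ) (a : ℕ) (ha : a < V) :
    countNat a (repWord V cnt) = cnt.getD a 0 := by
  rw [countNat_eq_count, repWord, List.count_flatMap, List.sum_map_eq_nsmul_single a]
  · rw [List.count_eq_one_of_mem List.nodup_range (List.mem_range.mpr ha)]
    simp
  · intro v hva _
    simp [Function.comp_apply, List.count_replicate, hva]

omit [CommRing R] [DecidableEq R] in
/-- The content of the canonical word of a content of length `V` is that content. [folklore] -/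
private theorem cntL_repWord (V : ℕ) (cnt : List ℕ) (hl : cnt.length = V) :
    cntL V (repWord V cnt) = cnt := by
  apply List.ext_getElem
  · simp [cntL, hl]
  · intro k h1 h2
    have hk : k < V := by simpa [cntL] using h1
    simp only [cntL, List.getElem_map, List.getElem_range]
    rw [countNat_repWord V cnt k hk, List.getD_eq_getElem _ _ h2]

/-- **The fast check implies the tree's table check** for a one-term point `c · ℓ_1 ⋯ ℓ_m`.
[cite: DorflerIkenmeyerPanova2020, §5 eq. (5.6) (the entries `α!·[x^α] ∏ ℓ_s`, arXiv p. 13)] -/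
theorem checkTable_of_checkTableFast (P : Point R) (V m : ℕ) (c : R) (fs : List (List R))
    (tab : List (List ℕ × R)) (hP : P.terms = [(c, fs)])
    (h : checkTableFast V m c fs tab = true) : checkTable P V m tab = true := by
  unfold checkTableFast at h
  simp only [Bool.and_eq_true, beq_iff_eq, List.all_eq_true, decide_eq_true_eq] at h
  obtain ⟨hlen, h⟩ := h
  unfold checkTable
  simp only [List.all_eq_true, decide_eq_true_eq]
  intro cnt hcnt
  obtain ⟨hl, _⟩ := length_sum_of_mem_allCounts V m cnt hcnt
  rw [h cnt hcnt, symEntryProd, hP, cntL_repWord V cnt hl,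
    lookupC_prodTable V fs cnt (hlen.symm ▸ hcnt)]
  simp

end Table

/-! ## §2 Keyed literal layers for the content-state programme -/

/-- The content state of a packed key: label `u < n` gets the list of the digits `(u, v)`, `v < V`,
of `key` in base `keyBase` (the inverse of the packing used by `layersM` on states with digits
`< keyBase`). [folklore] -/
def decodeStateM (V n key : ℕ) : List (List ℕ) :=
  (List.range n).map fun u => (List.range V).map fun v => key / keyBase ^ (u * V + v) % keyBase

/-- **Keyed literal layer** for `layersM`: `(key, value)` pairs expanded to `(key, state, value)` triples,
the state being decoded from the key. [folklore] -/
def decodeLayerM {R : Type*} (V n : ℕ) (L : List (ℕ × R)) : List (ℕ × List (List ℕ) × R) :=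
  L.map fun kv => (kv.1, decodeStateM V n kv.1, kv.2)

/-! ## §3 Sanity values (kernel) -/

/-- The fast check agrees with the tree's check on the landed reciprocal certificate
`DIP20Prop51Reciprocal47Q02.lean` (row `(10, 10, 7, 1)`, point `x · z · (x + 2y - w) · (x - 2y)`), and
decoding the key of the state "label 0 = (1,0,2,0), label 1 = (0,3,0,1)" returns that state. [folklore] -/
example :
    checkTableFast 4 4 (1 : ℤ) [[1, 0, 0, 0], [0, 0, 1, 0], [1, 2, 0, -1], [1, -2, 0, 0]]
        [([1, 1, 1, 1], 2), ([1, 2, 1, 0], -8), ([2, 0, 1, 1], -2), ([3, 0, 1, 0], 6)] = true ∧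
      decodeStateM 4 2 (1 + 2 * keyBase ^ 2 + 3 * keyBase ^ 5 + keyBase ^ 7) =
        [[1, 0, 2, 0], [0, 3, 0, 1]] := by
  decide +kernel

end TableauEval

end Literature.Computability.AlgebraicComplexity
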